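import Mathlib
import HarnessLib
import Summits.AtomisticToContinuum.FouriersLaw.Theses.JunctionLocality
import Literature.MathematicalPhysics.KineticTheory.LangevinChainGibbs
import Summits.AtomisticToContinuum.FouriersLaw.Theorems.JunctionLocalitySuperadditiveResistanceDeviceLiouville

/-!
# The plain chain at equilibrium, VI: the `μ_T`-adjoint of the generator against a smooth factor

Part VI of the helper development (`--supports` stmt-AtomisticToContinuum-11748) for stub
`stub_linearResponse` of the line `thermalise-then-cut-probe-insertion` (crux
`JunctionLocality.SuperadditiveResistance`); see `…DeviceLiouville` (Part V) for the overview of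
Parts I–V and `…PlainResponseUnique` (Part VII) for the use of this file. Content, for any
`OscillatorChain` with `C¹` potentials and `T ≠ 0`: `X_H` is a derivation (`liouvilleOp_mul`)
and is antisymmetric for `ρ_T dx` against a compactly supported factor
(`integral_liouvilleOp_mul`); each unit thermostat `S_i = T∂²_{p_i} − p_i∂_{p_i}` satisfies
`∫ (S_i f) g ρ_T = −T∫ ∂_{p_i}f ∂_{p_i}g ρ_T = ∫ f (S_i g) ρ_T` for `f ∈ C²_c`, `g ∈ C²` (two
Gaussian integrations by parts, `integral_thermo_site_mul`, `integral_thermo_site_symm`); hence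
`integral_generator_mul_eq_adjoint`: `∫ (L_T f) g ρ_T = ∫ f (−X_H g + γ S_{bathWeight} g) ρ_T` —
the plain generator at equal temperatures is `X_H + γ S_{bathWeight}`
(`generator_eq_liouvilleOp_add`) and its `μ_T`-adjoint on smooth functions is `−X_H + γ S`.
-/

noncomputable section

open MeasureTheory Filter Topology ProbabilityTheory
open scoped ContDiff NNReal
open Literature.MathematicalPhysics.KineticTheory.HeatConduction

namespace Summit.AtomisticToContinuum.FouriersLaw.Theorems.SuperadditiveResistance.DeviceLiouville

section PlainAdjoint

variable (P : OscillatorChain) {L : ℕ}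

/-- `X_H` is a derivation: `X_H(f g) = f X_H g + g X_H f`. [folklore] -/
theorem liouvilleOp_mul {f g : PhaseSpace L → ℝ} (hf : Differentiable ℝ f) (hg : Differentiable ℝ g)
    (x : PhaseSpace L) :
    liouvilleOp P L (fun y => f y * g y) x = f x * liouvilleOp P L g x + g x * liouvilleOp P L f x := by
  unfold liouvilleOp
  rw [Finset.mul_sum, Finset.mul_sum, ← Finset.sum_add_distrib]
  refine Finset.sum_congr rfl fun i _ => ?_
  rw [partialQ_mul hf hg, partialP_mul hf hg]
  ring

/-- At equal bath temperatures the plain generator is `X_H + γ S_B` with `B = bathWeight`. [folklore] -/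
theorem generator_eq_liouvilleOp_add (L : ℕ) (T : ℝ) (f : PhaseSpace L → ℝ) (x : PhaseSpace L) :
    P.generator L T T f x =
      liouvilleOp P L f x + P.γ * bathOp L (OscillatorChain.bathWeight L) T f x := by
  simp only [OscillatorChain.generator, liouvilleOp, bathOp, OscillatorChain.bathWeight]
  congr 1
  congr 1
  refine Finset.sum_congr rfl fun i _ => ?_
  split_ifs <;> ring

/-- Antisymmetry of `X_H` for the Gibbs density against a compactly supported factor:
`∫ (X_H f) g ρ = −∫ f (X_H g) ρ` (`f ∈ C¹_c`, `g ∈ C¹`, `C¹` potentials). [folklore] -/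
theorem integral_liouvilleOp_mul (hU : ContDiff ℝ 1 P.U) (hV : ContDiff ℝ 1 P.V) (L : ℕ) (T : ℝ)
    {f g : PhaseSpace L → ℝ} (hf : ContDiff ℝ 1 f) (hfc : HasCompactSupport f) (hg : ContDiff ℝ 1 g) :
    ∫ x, liouvilleOp P L f x * (g x * P.gibbsDensity L T x) =
      -∫ x, f x * (liouvilleOp P L g x * P.gibbsDensity L T x) := by
  have hfd := hf.differentiable one_ne_zero
  have hgd := hg.differentiable one_ne_zero
  have hfg : ContDiff ℝ 1 (fun y => f y * g y) := hf.mul hg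
  have hfgc : HasCompactSupport (fun y => f y * g y) := hfc.mul_right
  have hH1 : ContDiff ℝ 1 (P.hamiltonian L) := P.contDiff_hamiltonian hU hV L
  have hρc : Continuous (P.gibbsDensity L T) := P.continuous_gibbsDensity hU.continuous hV.continuous L T
  -- ∫ X_H(fg) ρ = 0, summed over sites
  have h0 : ∫ x, liouvilleOp P L (fun y => f y * g y) x * P.gibbsDensity L T x = 0 := by
    have intA : ∀ i, Integrable (fun x => (x.2 i * partialQ i (fun y => f y * g y) x -
        partialQ i (P.hamiltonian L) x * partialP i (fun y => f y * g y) x) * P.gibbsDensity L T x) := by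
      intro i
      have hQc := continuous_partialQ hfg one_ne_zero i
      have hPc := continuous_partialP hfg one_ne_zero i
      have hWc := P.continuous_partialQ_hamiltonian hH1 i
      refine Continuous.integrable_of_hasCompactSupport (by fun_prop) ?_
      exact (((hasCompactSupport_partialQ (hfg.differentiable one_ne_zero) hfgc i).mul_left
        (f := fun x : PhaseSpace L => x.2 i)).sub
        ((hasCompactSupport_partialP (hfg.differentiable one_ne_zero) hfgc i).mul_left)).mul_right
    simp only [liouvilleOp, Finset.sum_mul]
    rw [integral_finsetSum _ fun i _ => intA i]
    exact Finset.sum_eq_zero fun i _ => P.integral_liouville_mul_gibbsDensity hU hV L T hfg hfgc i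
  -- expand pointwise and split
  have hexp : (fun x => liouvilleOp P L (fun y => f y * g y) x * P.gibbsDensity L T x) = fun x =>
      f x * (liouvilleOp P L g x * P.gibbsDensity L T x) +
        liouvilleOp P L f x * (g x * P.gibbsDensity L T x) := by
    funext x
    rw [liouvilleOp_mul P hfd hgd]
    ring
  have hlioc : ∀ {u : PhaseSpace L → ℝ}, ContDiff ℝ 1 u → Continuous (liouvilleOp P L u) := by
    intro u hu
    have hQc := fun i => continuous_partialQ hu one_ne_zero i
    have hPc := fun i => continuous_partialP hu one_ne_zero i
    have hWc := fun i => P.continuous_partialQ_hamiltonian hH1 i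
    unfold liouvilleOp
    fun_prop
  have hlio_cs : HasCompactSupport (liouvilleOp P L f) := by
    have hq : ∀ i : Fin L, HasCompactSupport (partialQ i f) := fun i => hasCompactSupport_partialQ hfd hfc i
    have hp : ∀ i : Fin L, HasCompactSupport (partialP i f) := fun i => hasCompactSupport_partialP hfd hfc i
    simp only [hasCompactSupport_iff_eventuallyEq] at hq hp ⊢
    have hall := (Filter.eventually_all.2 hq).and (Filter.eventually_all.2 hp)
    filter_upwards [hall] with x hx
    simp only [Pi.zero_apply] at hx ⊢
    unfold liouvilleOp
    exact Finset.sum_eq_zero fun i _ => by rw [hx.1 i, hx.2 i]; ring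
  have i1 : Integrable (fun x => f x * (liouvilleOp P L g x * P.gibbsDensity L T x)) :=
    Continuous.integrable_of_hasCompactSupport (hf.continuous.mul ((hlioc hg).mul hρc)) hfc.mul_right
  have i2 : Integrable (fun x => liouvilleOp P L f x * (g x * P.gibbsDensity L T x)) :=
    Continuous.integrable_of_hasCompactSupport ((hlioc hf).mul (hg.continuous.mul hρc)) hlio_cs.mul_right
  rw [hexp, integral_add i1 i2] at h0
  linarith

/-- One Gaussian integration by parts at site `i`: `∫ (T∂²_{p_i} f − p_i ∂_{p_i} f) g ρ_T =
−T ∫ ∂_{p_i} f ∂_{p_i} g ρ_T` for `f ∈ C²_c`, `g ∈ C¹` (`C¹` potentials). [folklore] -/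
theorem integral_thermo_site_mul (hU : ContDiff ℝ 1 P.U) (hV : ContDiff ℝ 1 P.V) (L : ℕ) {T : ℝ}
    (hT : T ≠ 0) (i : Fin L) {f g : PhaseSpace L → ℝ} (hf : ContDiff ℝ 2 f) (hfc : HasCompactSupport f)
    (hg : ContDiff ℝ 1 g) :
    ∫ x, (T * partialP i (partialP i f) x - x.2 i * partialP i f x) * (g x * P.gibbsDensity L T x) =
      -T * ∫ x, partialP i f x * partialP i g x * P.gibbsDensity L T x := by
  have hfd := hf.differentiable two_ne_zero
  have hgd := hg.differentiable one_ne_zero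
  have hf1 : ContDiff ℝ 1 (partialP i f) := contDiff_partialP hf (by norm_num) i
  have hf1d := hf1.differentiable one_ne_zero
  have hPc : Continuous (partialP i f) := hf1.continuous
  have hPPc : Continuous (partialP i (partialP i f)) := continuous_partialP hf1 one_ne_zero i
  have hPs : HasCompactSupport (partialP i f) := hasCompactSupport_partialP hfd hfc i
  have hPPs : HasCompactSupport (partialP i (partialP i f)) := hasCompactSupport_partialP hf1d hPs i
  have hgPc : Continuous (partialP i g) := continuous_partialP hg one_ne_zero i
  have hρc : Continuous (P.gibbsDensity L T) := P.continuous_gibbsDensity hU.continuous hV.continuous L T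
  -- IBP: ∫ (g ρ) ∂(∂f) = -∫ ∂(g ρ) ∂f, with ∂(gρ) = (∂g - g p/T) ρ
  have e : ∫ x, (g x * P.gibbsDensity L T x) * partialP i (partialP i f) x =
      -∫ x, ((partialP i g x - g x * (x.2 i / T)) * P.gibbsDensity L T x) * partialP i f x := by
    apply integral_mul_eq_neg_of_hasLineDerivAt (v := ((0, Pi.single i 1) : PhaseSpace L))
      (hg.continuous.mul hρc) (by fun_prop) hPc hPPc hPs hPPs
    · intro x
      have hρ' := P.hasLineDerivAt_gibbsDensity (T := T) (P.hasLineDerivAt_hamiltonian_unitP L x i)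
      have hg' := hasLineDerivAt_partialP hgd i x
      unfold HasLineDerivAt at hρ' hg' ⊢
      have h2 := hg'.mul hρ'
      simp only [zero_smul, add_zero] at h2
      exact h2.congr_deriv (by ring)
    · exact fun x => hasLineDerivAt_partialP hf1d i x
  have hsplit : (fun x => (T * partialP i (partialP i f) x - x.2 i * partialP i f x) *
      (g x * P.gibbsDensity L T x)) = fun x =>
      T * ((g x * P.gibbsDensity L T x) * partialP i (partialP i f) x) -
        x.2 i * partialP i f x * g x * P.gibbsDensity L T x := by
    funext x; ring
  have j1 : Integrable (fun x => (g x * P.gibbsDensity L T x) * partialP i (partialP i f) x) :=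
    Continuous.integrable_of_hasCompactSupport (by fun_prop) hPPs.mul_left
  have j2 : Integrable (fun x => x.2 i * partialP i f x * g x * P.gibbsDensity L T x) :=
    Continuous.integrable_of_hasCompactSupport (by fun_prop) (hPs.mul_left.mul_right.mul_right)
  rw [hsplit, integral_sub (j1.const_mul T) j2, integral_const_mul, e]
  have hsplit2 : (fun x => ((partialP i g x - g x * (x.2 i / T)) * P.gibbsDensity L T x) * partialP i f x) =
      fun x => partialP i f x * partialP i g x * P.gibbsDensity L T x -
        T⁻¹ * (x.2 i * partialP i f x * g x * P.gibbsDensity L T x) := by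
    funext x
    field_simp
  have j3 : Integrable (fun x => partialP i f x * partialP i g x * P.gibbsDensity L T x) :=
    Continuous.integrable_of_hasCompactSupport (by fun_prop) (hPs.mul_right.mul_right)
  rw [hsplit2, integral_sub j3 (j2.const_mul _), integral_const_mul]
  have hTinv : T * T⁻¹ = 1 := mul_inv_cancel₀ hT
  linear_combination (∫ x, x.2 i * partialP i f x * g x * P.gibbsDensity L T x) * hTinv

/-- Symmetry of each thermostat for the Gibbs density against a compactly supported factor:
`∫ (S_i f) g ρ_T = ∫ f (S_i g) ρ_T` (`f ∈ C²_c`, `g ∈ C²`). [folklore] -/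
theorem integral_thermo_site_symm (hU : ContDiff ℝ 1 P.U) (hV : ContDiff ℝ 1 P.V) (L : ℕ) {T : ℝ}
    (hT : T ≠ 0) (i : Fin L) {f g : PhaseSpace L → ℝ} (hf : ContDiff ℝ 2 f) (hfc : HasCompactSupport f)
    (hg : ContDiff ℝ 2 g) :
    ∫ x, (T * partialP i (partialP i f) x - x.2 i * partialP i f x) * (g x * P.gibbsDensity L T x) =
      ∫ x, f x * ((T * partialP i (partialP i g) x - x.2 i * partialP i g x) * P.gibbsDensity L T x) := by
  rw [integral_thermo_site_mul P hU hV L hT i hf hfc (hg.of_le (by norm_num))]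
  have hfd := hf.differentiable two_ne_zero
  have hgd := hg.differentiable two_ne_zero
  have hg1 : ContDiff ℝ 1 (partialP i g) := contDiff_partialP hg (by norm_num) i
  have hg1d := hg1.differentiable one_ne_zero
  have hf1 : ContDiff ℝ 1 (partialP i f) := contDiff_partialP hf (by norm_num) i
  have hPc : Continuous (partialP i f) := hf1.continuous
  have hPs : HasCompactSupport (partialP i f) := hasCompactSupport_partialP hfd hfc i
  have hgPc : Continuous (partialP i g) := hg1.continuous
  have hgPPc : Continuous (partialP i (partialP i g)) := continuous_partialP hg1 one_ne_zero i
  have hρc : Continuous (P.gibbsDensity L T) := P.continuous_gibbsDensity hU.continuous hV.continuous L T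
  have hcs : HasCompactSupport (fun x => (partialP i f x - f x * (x.2 i / T)) * P.gibbsDensity L T x) :=
    (hPs.sub (hfc.mul_right (f' := fun x : PhaseSpace L => x.2 i / T))).mul_right
  -- ∫ (∂g) · ∂(f ρ) = -∫ (∂∂g) (f ρ) with ∂(fρ) = (∂f - f p/T) ρ
  have e : ∫ x, partialP i g x * ((partialP i f x - f x * (x.2 i / T)) * P.gibbsDensity L T x) =
      -∫ x, partialP i (partialP i g) x * (f x * P.gibbsDensity L T x) := by
    apply integral_mul_eq_neg_of_hasLineDerivAt (v := ((0, Pi.single i 1) : PhaseSpace L))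
      hgPc hgPPc (hf.continuous.mul hρc) (by fun_prop) hfc.mul_right hcs
    · exact fun x => hasLineDerivAt_partialP hg1d i x
    · intro x
      have hρ' := P.hasLineDerivAt_gibbsDensity (T := T) (P.hasLineDerivAt_hamiltonian_unitP L x i)
      have hf' := hasLineDerivAt_partialP hfd i x
      unfold HasLineDerivAt at hρ' hf' ⊢
      have h2 := hf'.mul hρ'
      simp only [zero_smul, add_zero] at h2
      exact h2.congr_deriv (by ring)
  have jA : Integrable (fun x => partialP i f x * partialP i g x * P.gibbsDensity L T x) :=
    Continuous.integrable_of_hasCompactSupport (by fun_prop) (hPs.mul_right.mul_right)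
  have jB : Integrable (fun x => x.2 i * f x * partialP i g x * P.gibbsDensity L T x) :=
    Continuous.integrable_of_hasCompactSupport (by fun_prop) (hfc.mul_left.mul_right.mul_right)
  have jC : Integrable (fun x => f x * partialP i (partialP i g) x * P.gibbsDensity L T x) :=
    Continuous.integrable_of_hasCompactSupport (by fun_prop) (hfc.mul_right.mul_right)
  have eL : ∫ x, partialP i g x * ((partialP i f x - f x * (x.2 i / T)) * P.gibbsDensity L T x) =
      (∫ x, partialP i f x * partialP i g x * P.gibbsDensity L T x) -
        T⁻¹ * ∫ x, x.2 i * f x * partialP i g x * P.gibbsDensity L T x := by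
    rw [← integral_const_mul, ← integral_sub jA (jB.const_mul _)]
    refine integral_congr_ae (ae_of_all _ fun x => ?_)
    field_simp
  have eC : ∫ x, partialP i (partialP i g) x * (f x * P.gibbsDensity L T x) =
      ∫ x, f x * partialP i (partialP i g) x * P.gibbsDensity L T x :=
    integral_congr_ae (ae_of_all _ fun x => by ring)
  have eR : ∫ x, f x * ((T * partialP i (partialP i g) x - x.2 i * partialP i g x) * P.gibbsDensity L T x) =
      T * (∫ x, f x * partialP i (partialP i g) x * P.gibbsDensity L T x) -
        ∫ x, x.2 i * f x * partialP i g x * P.gibbsDensity L T x := by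
    rw [← integral_const_mul, ← integral_sub (jC.const_mul _) jB]
    refine integral_congr_ae (ae_of_all _ fun x => ?_)
    ring
  rw [eL, eC] at e
  rw [eR]
  have hTinv : T * T⁻¹ = 1 := mul_inv_cancel₀ hT
  have e2 := congrArg (fun z => T * z) e
  simp only [mul_sub, ← mul_assoc, hTinv, one_mul, mul_neg] at e2
  linarith


/-- `X_H u` is continuous for `u ∈ C¹` (`C¹` potentials). [folklore] -/
theorem continuous_liouvilleOp (hU : ContDiff ℝ 1 P.U) (hV : ContDiff ℝ 1 P.V) {u : PhaseSpace L → ℝ}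
    (hu : ContDiff ℝ 1 u) : Continuous (liouvilleOp P L u) := by
  have hH1 : ContDiff ℝ 1 (P.hamiltonian L) := P.contDiff_hamiltonian hU hV L
  have hQc := fun i => continuous_partialQ hu one_ne_zero i
  have hPc := fun i => continuous_partialP hu one_ne_zero i
  have hWc := fun i => P.continuous_partialQ_hamiltonian hH1 i
  unfold liouvilleOp
  fun_prop

/-- `S_B u` is continuous for `u ∈ C²`. [folklore] -/
theorem continuous_bathOp {u : PhaseSpace L → ℝ} (hu : ContDiff ℝ 2 u) (B : Fin L → ℝ) (T : ℝ) :
    Continuous (bathOp L B T u) := by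
  have h1 : ∀ i, ContDiff ℝ 1 (partialP i u) := fun i => contDiff_partialP hu (by norm_num) i
  have hPc := fun i => (h1 i).continuous
  have hPPc := fun i => continuous_partialP (h1 i) one_ne_zero i
  unfold bathOp
  fun_prop

/-- **The plain generator against a smooth factor times the Gibbs density is the `μ_T`-adjoint
`L_T^† = −X_H + γ S` on that factor**: `∫ (L_T f) g ρ_T = ∫ f (−X_H g + γ S_{bathWeight} g) ρ_T`
for `f ∈ C²_c`, `g ∈ C²` (`C¹` potentials, `T ≠ 0`). [folklore] -/
theorem integral_generator_mul_eq_adjoint (hU : ContDiff ℝ 1 P.U) (hV : ContDiff ℝ 1 P.V) (L : ℕ)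
    {T : ℝ} (hT : T ≠ 0) {f g : PhaseSpace L → ℝ} (hf : ContDiff ℝ 2 f) (hfc : HasCompactSupport f)
    (hg : ContDiff ℝ 2 g) :
    ∫ x, P.generator L T T f x * (g x * P.gibbsDensity L T x) =
      ∫ x, f x * ((-liouvilleOp P L g x + P.γ * bathOp L (OscillatorChain.bathWeight L) T g x) *
        P.gibbsDensity L T x) := by
  have hf1 : ContDiff ℝ 1 f := hf.of_le (by norm_num)
  have hg1 : ContDiff ℝ 1 g := hg.of_le (by norm_num)
  have hfd := hf.differentiable two_ne_zero
  have hρc : Continuous (P.gibbsDensity L T) := P.continuous_gibbsDensity hU.continuous hV.continuous L T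
  have hfP1 : ∀ i, ContDiff ℝ 1 (partialP i f) := fun i => contDiff_partialP hf (by norm_num) i
  have hPs : ∀ i, HasCompactSupport (partialP i f) := fun i => hasCompactSupport_partialP hfd hfc i
  have hPPs : ∀ i, HasCompactSupport (partialP i (partialP i f)) := fun i =>
    hasCompactSupport_partialP ((hfP1 i).differentiable one_ne_zero) (hPs i) i
  have hPc : ∀ i, Continuous (partialP i f) := fun i => (hfP1 i).continuous
  have hPPc : ∀ i, Continuous (partialP i (partialP i f)) := fun i =>
    continuous_partialP (hfP1 i) one_ne_zero i
  -- integrable pieces of the left-hand side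
  have iL : Integrable (fun x => liouvilleOp P L f x * (g x * P.gibbsDensity L T x)) := by
    have : (fun x => liouvilleOp P L f x * (g x * P.gibbsDensity L T x)) =
        fun x => ∑ i, (x.2 i * partialQ i f x - partialQ i (P.hamiltonian L) x * partialP i f x) *
          (g x * P.gibbsDensity L T x) := by
      funext x; simp only [liouvilleOp, Finset.sum_mul]
    rw [this]
    refine integrable_finsetSum _ fun i _ => ?_
    have hH1 : ContDiff ℝ 1 (P.hamiltonian L) := P.contDiff_hamiltonian hU hV L
    have hQc := continuous_partialQ hf1 one_ne_zero i
    have hWc := P.continuous_partialQ_hamiltonian hH1 i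
    refine Continuous.integrable_of_hasCompactSupport (by fun_prop) ?_
    exact (((hasCompactSupport_partialQ hfd hfc i).mul_left (f := fun x : PhaseSpace L => x.2 i)).sub
      ((hPs i).mul_left)).mul_right
  have iS : ∀ i, Integrable (fun x => OscillatorChain.bathWeight L i *
      ((T * partialP i (partialP i f) x - x.2 i * partialP i f x) * (g x * P.gibbsDensity L T x))) := by
    intro i
    refine (Continuous.integrable_of_hasCompactSupport (by fun_prop) ?_).const_mul _
    exact (((hPPs i).mul_left).sub ((hPs i).mul_left)).mul_right
  -- integrable pieces of the right-hand side (compact support from `f`)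
  have jL : Integrable (fun x => f x * (liouvilleOp P L g x * P.gibbsDensity L T x)) :=
    Continuous.integrable_of_hasCompactSupport
      (hf.continuous.mul ((continuous_liouvilleOp P hU hV hg1).mul hρc)) hfc.mul_right
  have jS : ∀ i, Integrable (fun x => OscillatorChain.bathWeight L i *
      (f x * ((T * partialP i (partialP i g) x - x.2 i * partialP i g x) * P.gibbsDensity L T x))) := by
    intro i
    have hg1' : ContDiff ℝ 1 (partialP i g) := contDiff_partialP hg (by norm_num) i
    have hgPc := hg1'.continuous
    have hgPPc := continuous_partialP hg1' one_ne_zero i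
    exact (Continuous.integrable_of_hasCompactSupport (by fun_prop) hfc.mul_right).const_mul _
  -- rewrite both sides as sums of integrals
  have lhs : ∫ x, P.generator L T T f x * (g x * P.gibbsDensity L T x) =
      (∫ x, liouvilleOp P L f x * (g x * P.gibbsDensity L T x)) +
        P.γ * ∑ i, ∫ x, OscillatorChain.bathWeight L i *
          ((T * partialP i (partialP i f) x - x.2 i * partialP i f x) * (g x * P.gibbsDensity L T x)) := by
    rw [← integral_finsetSum _ fun i _ => iS i, ← integral_const_mul,
      ← integral_add iL ((integrable_finsetSum _ fun i _ => iS i).const_mul _)]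
    refine integral_congr_ae (ae_of_all _ fun x => ?_)
    dsimp only
    rw [generator_eq_liouvilleOp_add]
    simp only [bathOp, Finset.sum_mul, Finset.mul_sum, add_mul]
    congr 1
    refine Finset.sum_congr rfl fun i _ => ?_
    ring
  have rhs : ∫ x, f x * ((-liouvilleOp P L g x + P.γ * bathOp L (OscillatorChain.bathWeight L) T g x) *
        P.gibbsDensity L T x) =
      -(∫ x, f x * (liouvilleOp P L g x * P.gibbsDensity L T x)) +
        P.γ * ∑ i, ∫ x, OscillatorChain.bathWeight L i *
          (f x * ((T * partialP i (partialP i g) x - x.2 i * partialP i g x) * P.gibbsDensity L T x)) := by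
    have jLn : Integrable (fun x => -(f x * (liouvilleOp P L g x * P.gibbsDensity L T x))) := jL.neg
    rw [← integral_finsetSum _ fun i _ => jS i, ← integral_const_mul, ← integral_neg,
      ← integral_add jLn ((integrable_finsetSum _ fun i _ => jS i).const_mul _)]
    refine integral_congr_ae (ae_of_all _ fun x => ?_)
    dsimp only
    rw [show (∑ i, OscillatorChain.bathWeight L i *
        (f x * ((T * partialP i (partialP i g) x - x.2 i * partialP i g x) * P.gibbsDensity L T x))) =
        f x * P.gibbsDensity L T x * bathOp L (OscillatorChain.bathWeight L) T g x from by
      unfold bathOp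
      rw [Finset.mul_sum]
      exact Finset.sum_congr rfl fun i _ => by ring]
    ring
  rw [lhs, rhs, integral_liouvilleOp_mul P hU hV L T hf1 hfc hg1]
  congr 1
  congr 1
  refine Finset.sum_congr rfl fun i _ => ?_
  rw [integral_const_mul, integral_const_mul, integral_thermo_site_symm P hU hV L hT i hf hfc hg]


/-- Registered helper sub-goal `helper_plainAdjoint` (= `integral_generator_mul_eq_adjoint` in stub
form). [folklore] -/
theorem helper_plainAdjoint : ∀ (P : OscillatorChain), ContDiff ℝ 1 P.U → ContDiff ℝ 1 P.V → ∀ (L : ℕ) {T : ℝ}, T ≠ 0 → ∀ {f g : PhaseSpace L → ℝ}, ContDiff ℝ 2 f → HasCompactSupport f → ContDiff ℝ 2 g → ∫ x, P.generator L T T f x * (g x * P.gibbsDensity L T x) = ∫ x, f x * ((-liouvilleOp P L g x + P.γ * bathOp L (OscillatorChain.bathWeight L) T g x) * P.gibbsDensity L T x) :=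
  fun P hU hV L _ hT _ _ hf hfc hg => integral_generator_mul_eq_adjoint P hU hV L hT hf hfc hg

end PlainAdjoint

end Summit.AtomisticToContinuum.FouriersLaw.Theorems.SuperadditiveResistance.DeviceLiouville

end
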